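import Literature.Analysis.Asymptotics.MonomialSublevelAsymptotics
import HarnessLib

/-!
# From local monomializations at the zeros to a global decomposition of sublevel integrals

The *base* part of the gluing argument in the asymptotic theory of Laplace integrals (Lin 2017,
Prop. 2.5: cover the compact `Ω` by finitely many small neighbourhoods `Ω_x`, take a partition of
unity `σ_x` with `σ_x(x) > 0`, observe that points with `f(x) ≠ 0` do not contribute for small
levels, and collect the chart pieces of the zeros; AGV II §7.3, proof of Thm. 7.5), PROVED here in
complete generality for continuous `f, φ` on an open `U ⊇ Ω`:

* `exists_bump_partition` : a continuous partition of unity on a compact set, subordinate to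
  prescribed open neighbourhoods `V x` of its points, by finitely many functions `σ_x`
  (`x ∈ S ⊆ Ω`, `S` finite) each POSITIVE at its own centre;
* `exists_monomialPieces_of_local` : if at every zero `x ∈ Ω` of `f` the `σφ`-weighted sublevel
  integrals of `|f|` (for every continuous `σ ≥ 0` supported near `x`) decompose into finitely
  many monomial chart pieces whose amplitudes are `σ ∘ P_k` times fixed amplitudes positive at the
  origin (`P_k` continuous with `P_k(0) = x` — the resolution map in chart coordinates), then the
  `φ`-weighted sublevel integrals over all of `Ω` agree near `0⁺` with a finite sum of monomial
  chart pieces with amplitudes positive at the origin (the input of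
  `SublevelMonomialization.tendsto_of_monomialPieces`).

Everything is PROVED; no definitions, no named facts.

## References

* S. Lin, arXiv:1003.5338, Lemma 2.4, Prop. 2.5. [Lin2017]
* V. I. Arnold, S. M. Gusein-Zade, A. N. Varchenko, *Singularities of Differentiable Maps II*
  (2012), Part II §7.3, proof of Thm. 7.5. [ArnoldGuseinzadeVarchenko2012]
-/

noncomputable section

open MeasureTheory Filter Set Topology

open scoped ENNReal

namespace Literature.Analysis.Asymptotics.MonomialPhase

section Partition

variable {E : Type*} [MetricSpace E]

/-- **A continuous partition of unity positive at the centres.** For a compact `Ω` and open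
neighbourhoods `V x ∋ x` of its points there are finitely many centres `S ⊆ Ω` and continuous
`σ_x ≥ 0` (`x ∈ S`) with `tsupport σ_x ⊆ V x`, `σ_x(x) > 0` and `∑_{x ∈ S} σ_x = 1` on `Ω`.
[folklore] -/
theorem exists_bump_partition {Ω : Set E} (hΩ : IsCompact Ω) (V : E → Set E)
    (hV : ∀ x ∈ Ω, IsOpen (V x)) (hxV : ∀ x ∈ Ω, x ∈ V x) :
    ∃ S : Finset E, (∀ x ∈ S, x ∈ Ω) ∧ ∃ σ : E → E → ℝ,
      (∀ x ∈ S, Continuous (σ x)) ∧ (∀ x ∈ S, ∀ z, 0 ≤ σ x z) ∧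
      (∀ x ∈ S, tsupport (σ x) ⊆ V x) ∧ (∀ x ∈ S, 0 < σ x x) ∧
      (∀ z ∈ Ω, ∑ x ∈ S, σ x z = 1) := by
  classical
  rcases Ω.eq_empty_or_nonempty with hΩe | hΩne
  · refine ⟨∅, by simp, fun _ _ => 0, by simp, by simp, by simp, by simp, ?_⟩
    simp [hΩe]
  -- radii with `closedBall x (r x) ⊆ V x`
  have hr : ∀ x ∈ Ω, ∃ r : ℝ, 0 < r ∧ Metric.closedBall x r ⊆ V x := fun x hx =>
    Metric.nhds_basis_closedBall.mem_iff.1 ((hV x hx).mem_nhds (hxV x hx))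
  choose! r hr hrV using hr
  -- finite subcover by the half balls
  obtain ⟨S, hS, hcover⟩ := hΩ.elim_nhds_subcover (fun x => Metric.ball x (r x / 2))
    fun x hx => Metric.ball_mem_nhds x (half_pos (hr x hx))
  -- bumps
  set b : E → E → ℝ := fun x z => max 0 (1 - 2 * dist z x / r x) with hb
  have hbc : ∀ x ∈ S, Continuous (b x) := fun x hx => by
    have hr0 : r x ≠ 0 := (hr x (hS x hx)).ne'
    exact continuous_const.max (continuous_const.sub
      ((continuous_const.mul (continuous_id.dist continuous_const)).div_const _))
  have hb0 : ∀ x z, 0 ≤ b x z := fun x z => le_max_left _ _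
  have hbpos : ∀ x ∈ S, ∀ z, 0 < b x z ↔ dist z x < r x / 2 := by
    intro x hx z
    have hrx := hr x (hS x hx)
    simp only [hb, lt_max_iff, lt_irrefl, false_or, sub_pos]
    rw [div_lt_one hrx]
    constructor <;> intro h <;> linarith
  have hbsupp : ∀ x ∈ S, tsupport (b x) ⊆ V x := by
    intro x hx
    have hrx := hr x (hS x hx)
    refine Subset.trans ?_ (hrV x (hS x hx))
    refine closure_minimal ?_ Metric.isClosed_closedBall
    intro z hz
    rw [Function.mem_support] at hz
    have hz' : 0 < b x z := lt_of_le_of_ne (hb0 x z) (Ne.symm hz)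
    rw [hbpos x hx z] at hz'
    rw [Metric.mem_closedBall]
    linarith
  -- their sum is positive on `Ω`
  set B : E → ℝ := fun z => ∑ x ∈ S, b x z with hB
  have hBc : Continuous B := continuous_finsetSum _ fun x hx => hbc x hx
  have hBpos : ∀ z ∈ Ω, 0 < B z := by
    intro z hz
    obtain ⟨x, hx, hzx⟩ := mem_iUnion₂.1 (hcover hz)
    rw [Metric.mem_ball] at hzx
    exact lt_of_lt_of_le ((hbpos x hx z).2 hzx) (Finset.single_le_sum (fun y _ => hb0 y z) hx)
  obtain ⟨z₀, hz₀, hmin⟩ := hΩ.exists_isMinOn hΩne hBc.continuousOn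
  set m : ℝ := B z₀ with hm
  have hmpos : 0 < m := hBpos z₀ hz₀
  set B' : E → ℝ := fun z => max (B z) m with hB'
  have hB'c : Continuous B' := hBc.max continuous_const
  have hB'pos : ∀ z, 0 < B' z := fun z => lt_of_lt_of_le hmpos (le_max_right _ _)
  have hB'Ω : ∀ z ∈ Ω, B' z = B z := fun z hz => max_eq_left (hmin hz)
  refine ⟨S, hS, fun x z => b x z / B' z, fun x hx => (hbc x hx).div hB'c fun z => (hB'pos z).ne',
    fun x hx z => div_nonneg (hb0 x z) (hB'pos z).le, fun x hx => ?_, fun x hx => ?_,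
    fun z hz => ?_⟩
  · refine Subset.trans ?_ (hbsupp x hx)
    exact tsupport_mul_subset_left (f := b x) (g := fun z => (B' z)⁻¹)
  · refine div_pos ((hbpos x hx x).2 ?_) (hB'pos x)
    rw [dist_self]
    exact half_pos (hr x (hS x hx))
  · rw [← Finset.sum_div, hB'Ω z hz, div_self (hBpos z hz).ne']

end Partition

section Gluing

-- `E : Type` (not `Type*`): the global index type is a `Σ`-type over finitely many points of `E`
-- and the conclusion quantifies `∃ ι : Type`.
variable {E : Type} [NormedAddCommGroup E] [MeasurableSpace E] [BorelSpace E]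
  {μ : Measure E} [IsFiniteMeasureOnCompacts μ]

/-- **Local monomializations at the zeros ⇒ global monomial decomposition near `0⁺`** (the base
gluing of Lin 2017, Prop. 2.5 / AGV II §7.3 proof of Thm. 7.5, proved): see the module docstring.
[cite: Lin2017, Lemma 2.4, Prop. 2.5] [cite: ArnoldGuseinzadeVarchenko2012, Part II §7.3] -/
theorem exists_monomialPieces_of_local {U Ω : Set E} {f φ : E → ℝ} (hU : IsOpen U)
    (hf : ContinuousOn f U) (hφ : ContinuousOn φ U) (hΩ : IsCompact Ω) (hΩU : Ω ⊆ U) {d : ℕ}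
    (hloc : ∀ x ∈ Ω, f x = 0 → ∃ W : Set E, IsOpen W ∧ x ∈ W ∧
      ∃ (ι : Type) (_ : Fintype ι) (κ w : ι → Fin d → ℕ) (a ψ : ι → (Fin d → ℝ) → ℝ)
        (P : ι → (Fin d → ℝ) → E),
        (∀ k, κ k ≠ 0) ∧ (∀ k j, 0 < w k j) ∧ (∀ k, Continuous (a k)) ∧ (∀ k y, 0 < a k y) ∧
        (∀ k, Continuous (ψ k)) ∧ (∀ k, ∀ y ∈ Icc (0 : Fin d → ℝ) 1, 0 ≤ ψ k y) ∧
        (∀ k, 0 < ψ k 0) ∧ (∀ k, Continuous (P k)) ∧ (∀ k, P k 0 = x) ∧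
        ∀ σ : E → ℝ, Continuous σ → tsupport σ ⊆ W → (∀ z, 0 ≤ σ z) → ∀ t : ℝ, 0 < t →
          ∫ z in {z ∈ Ω | |f z| ≤ t}, σ z * φ z ∂μ =
            ∑ k, ∫ y in {y : Fin d → ℝ | a k y * ∏ j, y j ^ κ k j ≤ t}, σ (P k y) * ψ k y
              ∂(Measure.pi fun j => powMeasure (w k j : ℝ))) :
    ∃ (ι : Type) (_ : Fintype ι) (κ w : ι → Fin d → ℕ) (a ψ : ι → (Fin d → ℝ) → ℝ) (t₀ : ℝ),
      (∀ i, κ i ≠ 0) ∧ (∀ i j, 0 < w i j) ∧ (∀ i, Continuous (a i)) ∧ (∀ i x, 0 < a i x) ∧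
      (∀ i, Continuous (ψ i)) ∧ (∀ i, ∀ x ∈ Icc (0 : Fin d → ℝ) 1, 0 ≤ ψ i x) ∧
      (∀ i, 0 < ψ i 0) ∧ 0 < t₀ ∧
      ∀ t ∈ Ioo (0 : ℝ) t₀, ∫ z in {z ∈ Ω | |f z| ≤ t}, φ z ∂μ =
        ∑ i, ∫ y in {y : Fin d → ℝ | a i y * ∏ j, y j ^ κ i j ≤ t}, ψ i y
          ∂(Measure.pi fun j => powMeasure (w i j : ℝ)) := by
  classical
  -- local data at the zeros
  choose W hWo hxW ιx instx κx wx ax ψx Px hκx hwx hax hax0 hψxc hψx0 hψxpos hPxc hPx0 hidx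
    using hloc
  -- open neighbourhoods of all points of `Ω`
  let V : E → Set E := fun x =>
    if h : x ∈ Ω ∧ f x = 0 then W x h.1 h.2 else U ∩ f ⁻¹' {v | |f x| / 2 < |v|}
  have hVo : ∀ x ∈ Ω, IsOpen (V x) := by
    intro x hx
    by_cases h0 : f x = 0
    · simp only [V, dif_pos (And.intro hx h0)]
      exact hWo x hx h0
    · simp only [V, dif_neg (fun h : x ∈ Ω ∧ f x = 0 => h0 h.2)]
      exact hf.isOpen_inter_preimage hU (isOpen_lt continuous_const continuous_abs)
  have hxV : ∀ x ∈ Ω, x ∈ V x := by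
    intro x hx
    by_cases h0 : f x = 0
    · simp only [V, dif_pos (And.intro hx h0)]
      exact hxW x hx h0
    · simp only [V, dif_neg (fun h : x ∈ Ω ∧ f x = 0 => h0 h.2)]
      refine ⟨hΩU hx, ?_⟩
      simp only [mem_preimage, mem_setOf_eq]
      have := abs_pos.2 h0
      linarith
  obtain ⟨S, hS, σ, hσc, hσ0, hσsupp, hσpos, hσ1⟩ := exists_bump_partition hΩ V hVo hxV
  -- measurability / integrability
  have hΩm : MeasurableSet Ω := hΩ.isClosed.measurableSet
  have hAm : ∀ t, MeasurableSet {z ∈ Ω | |f z| ≤ t} := fun t =>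
    ((continuous_abs.comp_continuousOn (hf.mono hΩU)).preimage_isClosed_of_isClosed
      hΩ.isClosed isClosed_Iic (t := Iic t)).measurableSet
  have hint : ∀ x ∈ S, ∀ t, IntegrableOn (fun z => σ x z * φ z) {z ∈ Ω | |f z| ≤ t} μ :=
    fun x hx t => (((hσc x hx).continuousOn.mul (hφ.mono hΩU)).integrableOn_compact hΩ).mono_set
      fun z hz => hz.1
  -- splitting along the partition of unity
  have hsplit : ∀ t, ∫ z in {z ∈ Ω | |f z| ≤ t}, φ z ∂μ =
      ∑ x ∈ S, ∫ z in {z ∈ Ω | |f z| ≤ t}, σ x z * φ z ∂μ := by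
    intro t
    rw [← integral_finsetSum _ fun x hx => hint x hx t]
    refine setIntegral_congr_fun (hAm t) fun z hz => ?_
    rw [← Finset.sum_mul, hσ1 z hz.1, one_mul]
  -- the points with `f x ≠ 0` do not contribute for small levels
  have hvanish : ∀ x ∈ S, f x ≠ 0 → ∀ t, t < |f x| / 2 →
      ∫ z in {z ∈ Ω | |f z| ≤ t}, σ x z * φ z ∂μ = 0 := by
    intro x hx h0 t ht
    refine setIntegral_eq_zero_of_forall_eq_zero fun z hz => ?_
    by_cases hσz : σ x z = 0
    · rw [hσz, zero_mul]
    · exfalso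
      have hzV : z ∈ V x := hσsupp x hx (subset_tsupport _ (Function.mem_support.2 hσz))
      have hxΩ := hS x hx
      simp only [V, dif_neg (fun h : x ∈ Ω ∧ f x = 0 => h0 h.2), mem_inter_iff, mem_preimage,
        mem_setOf_eq] at hzV
      linarith [hz.2, hzV.2]
  -- the level bound
  set T : Finset E := S.filter fun x => f x ≠ 0 with hT
  set t₀ : ℝ := if h : T.Nonempty then T.inf' h (fun x => |f x| / 2) else 1 with ht₀
  have ht₀pos : 0 < t₀ := by
    rw [ht₀]
    split_ifs with h
    · rw [Finset.lt_inf'_iff]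
      intro x hx
      rw [hT, Finset.mem_filter] at hx
      exact half_pos (abs_pos.2 hx.2)
    · exact one_pos
  have ht₀le : ∀ x ∈ S, f x ≠ 0 → t₀ ≤ |f x| / 2 := by
    intro x hx h0
    have hxT : x ∈ T := by rw [hT, Finset.mem_filter]; exact ⟨hx, h0⟩
    have hne : T.Nonempty := ⟨x, hxT⟩
    rw [ht₀, dif_pos hne]
    exact Finset.inf'_le _ hxT
  -- the zeros and their local pieces
  set S₀ : Finset E := S.filter fun x => f x = 0 with hS₀
  have hmemΩ : ∀ x : ↥S₀, (x : E) ∈ Ω := fun x => hS x (Finset.mem_of_mem_filter _ x.2)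
  have hmemS : ∀ x : ↥S₀, (x : E) ∈ S := fun x => Finset.mem_of_mem_filter _ x.2
  have hmem0 : ∀ x : ↥S₀, f x = 0 := fun x => (Finset.mem_filter.1 x.2).2
  let I : ↥S₀ → Type := fun x => ιx x (hmemΩ x) (hmem0 x)
  letI instI : ∀ x, Fintype (I x) := fun x => instx x (hmemΩ x) (hmem0 x)
  -- local identities with `σ = σ_x`
  have hlocal : ∀ x : ↥S₀, ∀ t, 0 < t →
      ∫ z in {z ∈ Ω | |f z| ≤ t}, σ x z * φ z ∂μ =
        ∑ k : I x, ∫ y in {y : Fin d → ℝ | ax x (hmemΩ x) (hmem0 x) k y *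
          ∏ j, y j ^ κx x (hmemΩ x) (hmem0 x) k j ≤ t},
          σ x (Px x (hmemΩ x) (hmem0 x) k y) * ψx x (hmemΩ x) (hmem0 x) k y
            ∂(Measure.pi fun j => powMeasure (wx x (hmemΩ x) (hmem0 x) k j : ℝ)) := by
    intro x t ht
    refine hidx x (hmemΩ x) (hmem0 x) (σ x) (hσc x (hmemS x)) ?_ (hσ0 x (hmemS x)) t ht
    have h := hσsupp x (hmemS x)
    simp only [V, dif_pos (And.intro (hmemΩ x) (hmem0 x))] at h
    exact h
  -- the global family
  let ιt : Type := Σ x : ↥S₀, I x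
  let κt : ιt → Fin d → ℕ := fun p => κx p.1 (hmemΩ p.1) (hmem0 p.1) p.2
  let wt : ιt → Fin d → ℕ := fun p => wx p.1 (hmemΩ p.1) (hmem0 p.1) p.2
  let aT : ιt → (Fin d → ℝ) → ℝ := fun p => ax p.1 (hmemΩ p.1) (hmem0 p.1) p.2
  let ψt : ιt → (Fin d → ℝ) → ℝ := fun p y =>
    σ p.1 (Px p.1 (hmemΩ p.1) (hmem0 p.1) p.2 y) * ψx p.1 (hmemΩ p.1) (hmem0 p.1) p.2 y
  refine ⟨ιt, inferInstance, κt, wt, aT, ψt, t₀, fun p => ?_, fun p j => ?_, fun p => ?_,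
    fun p y => ?_, fun p => ?_, fun p y hy => ?_, fun p => ?_, ht₀pos, fun t ht => ?_⟩
  · exact hκx p.1 (hmemΩ p.1) (hmem0 p.1) p.2
  · exact hwx p.1 (hmemΩ p.1) (hmem0 p.1) p.2 j
  · exact hax p.1 (hmemΩ p.1) (hmem0 p.1) p.2
  · exact hax0 p.1 (hmemΩ p.1) (hmem0 p.1) p.2 y
  · exact ((hσc p.1 (hmemS p.1)).comp (hPxc p.1 (hmemΩ p.1) (hmem0 p.1) p.2)).mul
      (hψxc p.1 (hmemΩ p.1) (hmem0 p.1) p.2)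
  · exact mul_nonneg (hσ0 p.1 (hmemS p.1) _) (hψx0 p.1 (hmemΩ p.1) (hmem0 p.1) p.2 y hy)
  · show 0 < σ p.1 (Px p.1 (hmemΩ p.1) (hmem0 p.1) p.2 0) * ψx p.1 (hmemΩ p.1) (hmem0 p.1) p.2 0
    rw [hPx0]
    exact mul_pos (hσpos p.1 (hmemS p.1)) (hψxpos _ _ _ _)
  · rw [hsplit t, ← Finset.sum_filter_add_sum_filter_not S (fun x => f x = 0)]
    have hzero : ∑ x ∈ S.filter (fun x => ¬ f x = 0), ∫ z in {z ∈ Ω | |f z| ≤ t}, σ x z * φ z ∂μ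
        = 0 := by
      refine Finset.sum_eq_zero fun x hx => ?_
      rw [Finset.mem_filter] at hx
      exact hvanish x hx.1 hx.2 t (lt_of_lt_of_le ht.2 (ht₀le x hx.1 hx.2))
    rw [hzero, add_zero, ← hS₀, ← Finset.sum_coe_sort S₀, Fintype.sum_sigma]
    exact Finset.sum_congr rfl fun x _ => hlocal x t ht.1

end Gluing

end Literature.Analysis.Asymptotics.MonomialPhase

end
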